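import Summits.HodgeConjecture.HodgeConjecture.Theorems.Ring2AbelianAllAndreWeightLiftHodge
import Literature.AlgebraicGeometry.HodgeTheory.AbelianVarietyMultiplicationPullback
import HarnessLib

/-!
# Ring 2 · sub-cell AbelianAll (ALL ABELIAN VARIETIES), André axis, part XXV-a — THE LERAY WEIGHT PACKAGE FROM TWO SMALLER CLAUSES:
# a fibrewise multiplication `θ_N` (pure algebraic geometry) and ONE spectral clause on `ker j_t^*` (the characteristic roots off the fibre)

HONEST FRAMING (page 1, verbatim): **research route, not a corollary; conditional on HC_CM plus one named
minimal statement.** Cell line: research route conditional on HC_CM; not a corollary; Q11.4-sentence-2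
already refuted in dim ≥ 3. Nothing in this file proves a case of the Hodge conjecture for an abelian variety; `HC_CM`
(`RankFourFaces.CMAbelianHodge`) is a HYPOTHESIS of the two `HC_AV` rows, load-bearing as typed; item `Theses.RankFourFaces.CMToAbelian`
(stmt-16267) OPEN and not closed here. Seat `pub-hodge-ring2-ab-andre-2`, gen 17; brief (ii) "minimise … record each version" and (iii)
"attack `B_min`: what is known".

## What part XXIV left displayed, and what this file does about it

Parts XXIV-a…d carried the LERAY WEIGHT PACKAGE of a compact abelian pencil `f : 𝒳 ⟶ S` at a point `t` as THREE displayed hypotheses on a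
supplied endomorphism `ν` and a base `N ≥ 2` (bracket `CMWeights[]`): (wt) `j_t^* ν^* = Nᵏ j_t^*` on `Hᵏ(𝒳)`; (wt₃) every class is a sum of
three eigenclasses of weights `Nᵏ, N^{k-1}, N^{k-2}`; (top) a class of weight `Nᵏ` dying on `X_t` is zero. In print all three are theorems for
`ν = θ_N` (Kleiman 1968 p. 374; Milne 2020, proof of Prop. 1; Deninger–Murre 1991 Thm. 3.1), but (wt₃) and (top) are statements about the
Leray spectral sequence, which the tree does not have on these carriers. THIS FILE PROVES, in the kernel:

§1 (linear algebra, any field) for an endomorphism `T` of `V` and a linear `j : V → W` with `j ∘ T = a·j`: if `(T - b)(T - c)` kills `ker j`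
then `(T-a)(T-b)(T-c) = 0` on `V`; for `a, b, c` pairwise distinct every vector is a sum of three eigenvectors (Lagrange interpolation,
**`exists_eigenDecomp_of_ker_roots`**), and for `a ∉ {b, c}` an `a`-eigenvector in `ker j` is zero (**`eq_zero_of_ker_roots`**).

§2 (carriers) hence on `Hᵏ(𝒳)`: **(wt) ∧ (roots) ⟹ (wt₃) ∧ (top)**, where
* (roots) `∀ w ∈ ker j_t^* ⊂ Hᵏ(𝒳)`, `ν^*ν^* w - (N^{k-1} + N^{k-2})·ν^* w + N^{k-1}N^{k-2}·w = 0` — "off the fibre, `θ_N^*` has the two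
  characteristic roots `N^{k-1}, N^{k-2}`" (truncated subtraction: for `k = 1` this reads `(ν^* - 1)² = 0` on `ker j_t^* = f^* H¹(S)`). In print
  `ker j_t^* = L¹Hᵏ = H¹(S, R^{k-1} f_*) ⊕ H²(S, R^{k-2} f_*)`, on which `θ_N^*` acts as `N^{k-1}`, `N^{k-2}`. THIS is the one clause of the
  package that is not a single-fibre statement (`theorems weights₃_of_roots`, `top_of_roots`; degree `0`: `top_zero` from connectedness).

§3 (carriers) **(wt) IS A TREE THEOREM for a fibrewise multiplication**: if `ν` restricts along `j_t` to an endomorphism `ν_t` of `X_t` which a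
chart `e : A.X ≅ X_t` identifies with `N · 𝟙_A` (multiplication by `N` on the abelian variety `A`), then `j_t^* ν^* = Nᵏ j_t^*` on `Hᵏ(𝒳)` for
every `k` (**`fibreWeight_of_chart`**; the tree's `[m]^* = mᵏ` on `Hᵏ(A(ℂ))`, `complexBetti_map_nsmul_id_apply`, Mumford §19).

§4 (node level, display-only brackets, REFEREE-AB F-ab-103) the new bracket **`CMThetaRoots[]`**: at every CM point `t` of every compact
abelian pencil there are a locally quasi-finite `ν : 𝒳 ⟶ 𝒳`, `N ≥ 2`, a restriction `ν_t` of `ν` to `X_t` charted by `N · 𝟙_A`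
(print: `ν = θ_N`; a compact pencil is an abelian scheme, Mumford GIT Thm. 6.14, and `θ_N` restricts to `[N]` on every fibre), and (roots) in
every degree. **`cmWeights_of_cmThetaRoots : CMThetaRoots[] → CMWeights[]`**; hence the rows of parts XXIV-c/d from the smaller bracket:
`HC_AV_of_HC_CM_of_cmTopWeightHodge_of_thetaRoots (h₂₁) (hΘ : CMThetaRoots[]) (hCM) (h : CMTopWeightHodge[])`, the exactness
`HC_AV_iff_HC_CM_and_cmTopWeightHodge_of_verdier_of_thetaRoots`, and the `CMTopWeightLifts[]` twins.

## Honest status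

No node is born (brackets display-only); nothing is minimal; nothing here is fact-free progress on `HC_AV`; the weight package is NOT
discharged — it is REDUCED: of its three spectral clauses, (wt) is now a theorem given the geometric datum "`θ_N` exists and restricts to
`[N]` on `X_t`" (abelian-scheme structure, print), (wt₃) and (top) are theorems given (wt) and the single clause (roots) on `ker j_t^*`.
(roots) is what parts XXV-b/c attack (the action of `ν^*` on `L¹Hᵏ` through the punctured pencil `𝒳 ∖ X_t → S ∖ t`, Mayer–Vietoris over
`1`-skeleta, purity along `X_t`, base change for the Gysin map). `HC_CM` is a load-bearing binder of the two `HC_AV` rows only.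

References: Kleiman1968AlgebraicCycles (p. 374); Milne2020HodgeClassesAV (proof of Prop. 1, pp. 7–8); DeningerMurre1991 (Thm. 3.1);
MumfordAV1970 (§1 (3), §19); MumfordGIT (Thm. 6.14); VoisinHodgeII2003 (§4.2.3, Thm. 4.18); HatcherAT2002 (§3.1); Andre1996Motifs (§6.3).
-/

noncomputable section

set_option linter.dupNamespace false

namespace Summit.HodgeConjecture.HodgeConjecture.Ring2.AbelianAll

open CategoryTheory AlgebraicGeometry
open Literature.AlgebraicGeometry Literature.AlgebraicGeometry.Motives
open Literature.AlgebraicGeometry.HodgeTheory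
open Literature.AlgebraicGeometry.Deligne1982 (cmLocus)
open Literature.AlgebraicGeometry.Andre1996 (andre1996_cmAnchoredPencil)
open Literature.AlgebraicTopology.SingularHomology (singularCohomology)
open Summit.HodgeConjecture.HodgeConjecture
open Summit.HodgeConjecture.HodgeConjecture.Theses
open Summit.HodgeConjecture.HodgeConjecture.Ring2.Deform (HC_CM_of_HC_AV)
open Summit.HodgeConjecture.HodgeConjecture.Ring2.Hypotheses (cmPowerLocus)

/-! ## §1 Linear algebra: three characteristic roots, the top one visible on `j` -/

section LinearAlgebra

variable {K V W : Type*} [Field K] [AddCommGroup V] [Module K V] [AddCommGroup W] [Module K W]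
  (T : V →ₗ[K] V) (j : V →ₗ[K] W) {a b c : K}

/-- **An `a`-eigenvector killed by `j` vanishes** when `(T-b)(T-c)` kills `ker j` and `a ∉ {b, c}`: `(a-b)(a-c)·G = 0`. This is the shape of
(top): a top-weight class dying on the fibre is zero. [cite: Milne2020HodgeClassesAV, proof of Prop. 1 (p. 7)] [folklore] -/
theorem eq_zero_of_ker_roots (hroots : ∀ v, j v = 0 → T (T v) - (b + c) • T v + (b * c) • v = 0) (hab : a ≠ b) (hac : a ≠ c)
    {G : V} (hG : T G = a • G) (hjG : j G = 0) : G = 0 := by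
  have h := hroots G hjG
  have h' : ((a - b) * (a - c)) • G = 0 := by
    rw [← h, hG, map_smul, hG]
    module
  exact (smul_eq_zero.1 h').resolve_left (mul_ne_zero (sub_ne_zero.2 hab) (sub_ne_zero.2 hac))

/-- The cubic relation `T³ - (a+b+c)T² + (ab+ac+bc)T - abc = 0` on `V` from `j ∘ T = a·j` and "`(T-b)(T-c)` kills `ker j`" (`(T-a)v ∈ ker j`).
[folklore] -/
theorem cubic_eq_zero_of_ker_roots (hwt : ∀ v, j (T v) = a • j v)
    (hroots : ∀ v, j v = 0 → T (T v) - (b + c) • T v + (b * c) • v = 0) (v : V) :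
    T (T (T v)) - (a + b + c) • T (T v) + (a * b + a * c + b * c) • T v - (a * b * c) • v = 0 := by
  have hu : j (T v - a • v) = 0 := by rw [map_sub, map_smul, hwt, sub_self]
  have h := hroots _ hu
  have e1 : T (T v - a • v) = T (T v) - a • T v := by rw [map_sub, map_smul]
  have e2 : T (T (T v - a • v)) = T (T (T v)) - a • T (T v) := by rw [e1, map_sub, map_smul]
  rw [e2, e1] at h
  calc T (T (T v)) - (a + b + c) • T (T v) + (a * b + a * c + b * c) • T v - (a * b * c) • v
      = T (T (T v)) - a • T (T v) - (b + c) • (T (T v) - a • T v) + (b * c) • (T v - a • v) := by module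
    _ = 0 := h

/-- **Three-eigenvector decomposition by Lagrange interpolation**: under `j ∘ T = a·j`, "`(T-b)(T-c)` kills `ker j`" and `a, b, c` pairwise
distinct, every `v` is `v₀ + v₁ + v₂` with `T vᵢ` the `a`-, `b`-, `c`-multiple of `vᵢ` (`v₀ = (T-b)(T-c)v/((a-b)(a-c))` etc.). This is the
shape of (wt₃). [cite: Milne2020HodgeClassesAV, proof of Prop. 1 (p. 7)] [folklore] -/
theorem exists_eigenDecomp_of_ker_roots (hwt : ∀ v, j (T v) = a • j v)
    (hroots : ∀ v, j v = 0 → T (T v) - (b + c) • T v + (b * c) • v = 0) (hab : a ≠ b) (hac : a ≠ c) (hbc : b ≠ c) (v : V) :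
    ∃ v₀ v₁ v₂ : V, v = v₀ + v₁ + v₂ ∧ T v₀ = a • v₀ ∧ T v₁ = b • v₁ ∧ T v₂ = c • v₂ := by
  have hR := cubic_eq_zero_of_ker_roots T j hwt hroots v
  have hab' : a - b ≠ 0 := sub_ne_zero.2 hab
  have hac' : a - c ≠ 0 := sub_ne_zero.2 hac
  have hbc' : b - c ≠ 0 := sub_ne_zero.2 hbc
  have hba' : b - a ≠ 0 := sub_ne_zero.2 (Ne.symm hab)
  have hca' : c - a ≠ 0 := sub_ne_zero.2 (Ne.symm hac)
  have hcb' : c - b ≠ 0 := sub_ne_zero.2 (Ne.symm hbc)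
  refine ⟨((a - b) * (a - c))⁻¹ • (T (T v) - (b + c) • T v + (b * c) • v),
    ((b - a) * (b - c))⁻¹ • (T (T v) - (a + c) • T v + (a * c) • v),
    ((c - a) * (c - b))⁻¹ • (T (T v) - (a + b) • T v + (a * b) • v), ?_, ?_, ?_, ?_⟩
  · match_scalars <;> field_simp <;> ring
  · rw [← sub_eq_zero]
    calc T (((a - b) * (a - c))⁻¹ • (T (T v) - (b + c) • T v + (b * c) • v)) -
          a • (((a - b) * (a - c))⁻¹ • (T (T v) - (b + c) • T v + (b * c) • v))
        = ((a - b) * (a - c))⁻¹ • (T (T (T v)) - (a + b + c) • T (T v) + (a * b + a * c + b * c) • T v - (a * b * c) • v) := by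
          simp only [map_sub, map_add, map_smul]
          module
      _ = 0 := by rw [hR, smul_zero]
  · rw [← sub_eq_zero]
    calc T (((b - a) * (b - c))⁻¹ • (T (T v) - (a + c) • T v + (a * c) • v)) -
          b • (((b - a) * (b - c))⁻¹ • (T (T v) - (a + c) • T v + (a * c) • v))
        = ((b - a) * (b - c))⁻¹ • (T (T (T v)) - (a + b + c) • T (T v) + (a * b + a * c + b * c) • T v - (a * b * c) • v) := by
          simp only [map_sub, map_add, map_smul]
          module
      _ = 0 := by rw [hR, smul_zero]
  · rw [← sub_eq_zero]
    calc T (((c - a) * (c - b))⁻¹ • (T (T v) - (a + b) • T v + (a * b) • v)) -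
          c • (((c - a) * (c - b))⁻¹ • (T (T v) - (a + b) • T v + (a * b) • v))
        = ((c - a) * (c - b))⁻¹ • (T (T (T v)) - (a + b + c) • T (T v) + (a * b + a * c + b * c) • T v - (a * b * c) • v) := by
          simp only [map_sub, map_add, map_smul]
          module
      _ = 0 := by rw [hR, smul_zero]

end LinearAlgebra

/-! ## §2 Carriers: (wt) ∧ (roots) ⟹ (wt₃) ∧ (top) on `Hᵏ(𝒳)` -/

section Carriers

variable {𝒳 S : SchemeOver ℂ} {d : ℕ} {f : 𝒳 ⟶ S}

/-- The Leray weights are pairwise distinct as complex numbers: `Nᵃ ≠ Nᵇ` for `N ≥ 2`, `a ≠ b`. [folklore] -/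
theorem natCast_pow_ne_pow {N a b : ℕ} (hN : 2 ≤ N) (hab : a ≠ b) : (N : ℂ) ^ a ≠ (N : ℂ) ^ b := by
  intro h
  rw [← Nat.cast_pow, ← Nat.cast_pow, Nat.cast_inj] at h
  exact hab (Nat.pow_right_injective hN h)

/-- **(wt) ∧ (roots) ⟹ (wt₃)** in degree `k ≥ 2` (`k₁ + 1 = k`, `k₂ + 1 = k₁`): every `w ∈ Hᵏ(𝒳)` is `w₀ + w₁ + w₂` with
`ν^* wᵢ = N^{k-i} wᵢ`. Print (for `ν = θ_N` on an abelian scheme over a curve): the three Leray pieces `H⁰(S,Rᵏ)`, `H¹(S,R^{k-1})`,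
`H²(S,R^{k-2})`. [cite: Milne2020HodgeClassesAV, proof of Prop. 1 (p. 7)] [cite: Kleiman1968AlgebraicCycles, p. 374] [cite: DeningerMurre1991, Thm. 3.1] -/
theorem weights₃_of_roots (t : ComplexPoints S) (ν : 𝒳 ⟶ 𝒳) {N : ℕ} (hN : 2 ≤ N) {k k₁ k₂ : ℕ} (hk₁ : k₁ + 1 = k) (hk₂ : k₂ + 1 = k₁)
    (hwt : ∀ w : complexBetti 𝒳 k,
      complexBetti.map (fiberι f t) k (complexBetti.map ν k w) = ((N : ℂ) ^ k) • complexBetti.map (fiberι f t) k w)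
    (hroots : ∀ w : complexBetti 𝒳 k, complexBetti.map (fiberι f t) k w = 0 →
      complexBetti.map ν k (complexBetti.map ν k w) - ((N : ℂ) ^ (k - 1) + (N : ℂ) ^ (k - 2)) • complexBetti.map ν k w +
        ((N : ℂ) ^ (k - 1) * (N : ℂ) ^ (k - 2)) • w = 0)
    (w : complexBetti 𝒳 k) :
    ∃ w₀ w₁ w₂ : complexBetti 𝒳 k, w = w₀ + w₁ + w₂ ∧ complexBetti.map ν k w₀ = ((N : ℂ) ^ k) • w₀ ∧
      complexBetti.map ν k w₁ = ((N : ℂ) ^ k₁) • w₁ ∧ complexBetti.map ν k w₂ = ((N : ℂ) ^ k₂) • w₂ := by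
  have e₁ : k - 1 = k₁ := by omega
  have e₂ : k - 2 = k₂ := by omega
  rw [e₁, e₂] at hroots
  exact exists_eigenDecomp_of_ker_roots (complexBetti.map ν k).hom (complexBetti.map (fiberι f t) k).hom
    (a := (N : ℂ) ^ k) (b := (N : ℂ) ^ k₁) (c := (N : ℂ) ^ k₂) hwt hroots
    (natCast_pow_ne_pow hN (by omega)) (natCast_pow_ne_pow hN (by omega)) (natCast_pow_ne_pow hN (by omega)) w

/-- **(wt) ∧ (roots) ⟹ (top)** in every degree `k ≥ 1`: a class of weight `Nᵏ` dying on `X_t` is zero (`Nᵏ ∉ {N^{k-1}, N^{k-2}}`, truncated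
subtraction; for `k = 1` the clause (roots) reads `(ν^* - 1)² = 0` on `ker j_t^*`). Print: `E_∞^{0,k} = H⁰(S, Rᵏ f_*) ↪ Hᵏ(X_t)`.
[cite: Milne2020HodgeClassesAV, proof of Prop. 1 (p. 7)] [cite: VoisinHodgeII2003, §4.3.1 Thm. 4.18] -/
theorem top_of_roots (t : ComplexPoints S) (ν : 𝒳 ⟶ 𝒳) {N : ℕ} (hN : 2 ≤ N) {k : ℕ} (hk : 1 ≤ k)
    (hroots : ∀ w : complexBetti 𝒳 k, complexBetti.map (fiberι f t) k w = 0 →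
      complexBetti.map ν k (complexBetti.map ν k w) - ((N : ℂ) ^ (k - 1) + (N : ℂ) ^ (k - 2)) • complexBetti.map ν k w +
        ((N : ℂ) ^ (k - 1) * (N : ℂ) ^ (k - 2)) • w = 0)
    {G : complexBetti 𝒳 k} (hG : complexBetti.map ν k G = ((N : ℂ) ^ k) • G) (hjG : complexBetti.map (fiberι f t) k G = 0) : G = 0 :=
  eq_zero_of_ker_roots (complexBetti.map ν k).hom (complexBetti.map (fiberι f t) k).hom (a := (N : ℂ) ^ k)
    (b := (N : ℂ) ^ (k - 1)) (c := (N : ℂ) ^ (k - 2)) hroots (natCast_pow_ne_pow hN (by omega)) (natCast_pow_ne_pow hN (by omega)) hG hjG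

/-- **(top) in degree `0` needs no weights**: `H⁰(𝒳) → H⁰(X_t)` is injective (both spaces of complex points are path connected, `H⁰` is the
line spanned by `1`, and `j_t^* 1 = 1 ≠ 0`). [cite: HatcherAT2002, §3.1 p. 199] -/
theorem top_zero (hf : IsCompactAbelianPencil f d) (t : ComplexPoints S) {G : complexBetti 𝒳 0}
    (hjG : complexBetti.map (fiberι f t) 0 G = 0) : G = 0 := by
  haveI := hf.isSmoothProjective_total.pathConnectedSpace
  haveI := (hf.isSmoothProjective_fiberOver t).pathConnectedSpace
  obtain ⟨a, ha⟩ := Literature.Topology.FourManifolds.ComplexProjectiveSpace.exists_eq_smul_one (K := ℂ) G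
  have h1 : singularCohomology.one ℂ (ComplexPoints (fiberOver f t)) ≠ 0 := by
    intro h0
    have hrk := Literature.Topology.FourManifolds.ComplexProjectiveSpace.finrank_singularCohomology_zero
      (K := ℂ) (X := ComplexPoints (fiberOver f t))
    have htop : (⊤ : Submodule ℂ (complexBetti (fiberOver f t) 0)) = ⊥ := by
      rw [eq_bot_iff]
      intro x _
      obtain ⟨b, hb⟩ := Literature.Topology.FourManifolds.ComplexProjectiveSpace.exists_eq_smul_one (K := ℂ) x
      rw [Submodule.mem_bot, hb, h0, smul_zero]
    have := finrank_top ℂ (complexBetti (fiberOver f t) 0)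
    rw [htop, finrank_bot, hrk] at this
    exact zero_ne_one this
  have hmap : complexBetti.map (fiberι f t) 0 G = a • singularCohomology.one ℂ (ComplexPoints (fiberOver f t)) := by
    rw [ha, map_smul]
    change a • Literature.AlgebraicTopology.SingularHomology.singularCohomology.map ℂ ℂ
      (AlgPoints.mapContinuous (L := ℂ) (fiberι f t)) 0 (singularCohomology.one ℂ (ComplexPoints 𝒳)) = _
    rw [Literature.AlgebraicTopology.SingularHomology.singularCohomology.map_one]
  rw [hmap] at hjG
  rcases smul_eq_zero.1 hjG with h | h
  · rw [ha, h, zero_smul]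
  · exact absurd h h1

end Carriers

/-! ## §3 (wt) is a tree theorem for a fibrewise multiplication -/

section FibreWeight

variable {𝒳 S : SchemeOver ℂ} {f : 𝒳 ⟶ S}

/-- **A fibre endomorphism charted by `[N]` acts as `Nᵏ` on `Hᵏ(X_t)`**: if `e : A.X ≅ X_t` and `e ≫ ν_t = [N] ≫ e`, then `ν_t^* x = Nᵏ·x`
(the tree's `[N]^* = Nᵏ` on `Hᵏ(A(ℂ); ℂ)`, Mumford §19, transported along the chart). [cite: MumfordAV1970, §1 (3) and §19] -/
theorem map_fiberEndo_eq_smul_of_chart (t : ComplexPoints S) (νt : fiberOver f t ⟶ fiberOver f t) (A : AbelianVariety ℂ)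
    (e : A.X ≅ fiberOver f t) (N : ℕ) (he : e.hom ≫ νt = (N • 𝟙 A).hom.hom.hom ≫ e.hom) (k : ℕ) (x : complexBetti (fiberOver f t) k) :
    complexBetti.map νt k x = ((N : ℂ) ^ k) • x := by
  -- `e^*(ν_t^* x) = [N]^*(e^* x) = Nᵏ · e^* x = e^*(Nᵏ · x)`, and `e^*` is injective
  have h : complexBetti.map e.hom k (complexBetti.map νt k x) = complexBetti.map e.hom k (((N : ℂ) ^ k) • x) := by
    rw [← CategoryTheory.comp_apply, ← complexBetti.map_comp, he, complexBetti.map_comp, CategoryTheory.comp_apply, map_smul]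
    exact complexBetti_map_nsmul_id_apply A N k _
  have hinj : Function.Injective (complexBetti.map e.hom k) := by
    intro y y' hyy'
    have := congrArg (complexBetti.map e.inv k) hyy'
    rwa [← CategoryTheory.comp_apply, ← CategoryTheory.comp_apply, ← complexBetti.map_comp, Iso.inv_hom_id, complexBetti.map_id,
      CategoryTheory.id_apply, CategoryTheory.id_apply] at this
  exact hinj h

/-- **(wt) FROM A FIBREWISE MULTIPLICATION**: if `ν : 𝒳 ⟶ 𝒳` restricts along `j_t` to `ν_t` (`ν_t ≫ j_t = j_t ≫ ν`) and a chart
`e : A.X ≅ X_t` identifies `ν_t` with `N · 𝟙_A`, then `j_t^*(ν^* w) = Nᵏ · j_t^* w` for every `w ∈ Hᵏ(𝒳)` and every `k`. For `ν = θ_N` on an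
abelian scheme this is the print sentence "`θ_n^*` acts as `nʲ` on `Rʲ f_* ℚ`" read on the fibre. [cite: Milne2020HodgeClassesAV, proof of Prop. 1 (p. 7)]
[cite: Kleiman1968AlgebraicCycles, p. 374] [cite: MumfordAV1970, §19] -/
theorem fibreWeight_of_chart (t : ComplexPoints S) (ν : 𝒳 ⟶ 𝒳) (νt : fiberOver f t ⟶ fiberOver f t)
    (hνt : νt ≫ fiberι f t = fiberι f t ≫ ν) (A : AbelianVariety ℂ) (e : A.X ≅ fiberOver f t) (N : ℕ)
    (he : e.hom ≫ νt = (N • 𝟙 A).hom.hom.hom ≫ e.hom) (k : ℕ) (w : complexBetti 𝒳 k) :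
    complexBetti.map (fiberι f t) k (complexBetti.map ν k w) = ((N : ℂ) ^ k) • complexBetti.map (fiberι f t) k w := by
  rw [map_fiberι_map_eq_of_comm f ν t νt hνt k w]
  exact map_fiberEndo_eq_smul_of_chart t νt A e N he k _

end FibreWeight

/-! ## §4 Node level (display-only brackets): `CMThetaRoots[] ⟹ CMWeights[]` and the rows of part XXIV from the smaller bracket -/

section Nodes

/-- DISPLAY-ONLY bracket (no `def`; REFEREE-AB F-ab-103): `CMWeights[]` of part XXIV-c, restated verbatim (the Leray weight package (wt),
(wt₃), (top) at every CM point). -/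
local notation3 (prettyPrint := false) "CMWeights[]" =>
  ∀ ⦃d : ℕ⦄ ⦃𝒳 S : SchemeOver ℂ⦄ (f : 𝒳 ⟶ S), IsCompactAbelianPencil f d → ∀ t ∈ cmLocus f d,
    ∃ (ν : 𝒳 ⟶ 𝒳) (_ : LocallyQuasiFinite ν.left) (N : ℕ), 2 ≤ N ∧
      (∀ (k : ℕ) (w : complexBetti 𝒳 k), complexBetti.map (fiberι f t) k (complexBetti.map ν k w) =
        ((N : ℂ) ^ k) • complexBetti.map (fiberι f t) k w) ∧
      (∀ (k k₁ k₂ : ℕ), k₁ + 1 = k → k₂ + 1 = k₁ → ∀ w : complexBetti 𝒳 k, ∃ w₀ w₁ w₂ : complexBetti 𝒳 k,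
        w = w₀ + w₁ + w₂ ∧ complexBetti.map ν k w₀ = ((N : ℂ) ^ k) • w₀ ∧ complexBetti.map ν k w₁ = ((N : ℂ) ^ k₁) • w₁ ∧
        complexBetti.map ν k w₂ = ((N : ℂ) ^ k₂) • w₂) ∧
      (∀ (k : ℕ) (G : complexBetti 𝒳 k), complexBetti.map ν k G = ((N : ℂ) ^ k) • G →
        complexBetti.map (fiberι f t) k G = 0 → G = 0)

/-- DISPLAY-ONLY bracket (no `def`; REFEREE-AB F-ab-103): `CMTopWeightHodge[]` of part XXIV-d, restated verbatim. OPEN; a HYPOTHESIS. -/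
local notation3 (prettyPrint := false) "CMTopWeightHodge[]" =>
  ∀ ⦃d : ℕ⦄ ⦃𝒳 S : SchemeOver ℂ⦄ (f : 𝒳 ⟶ S), IsCompactAbelianPencil f d → ∀ t ∈ cmLocus f d,
    ∀ (ν : 𝒳 ⟶ 𝒳) (_ : LocallyQuasiFinite ν.left) (N : ℕ), 2 ≤ N →
      (∀ (k : ℕ) (w : complexBetti 𝒳 k), complexBetti.map (fiberι f t) k (complexBetti.map ν k w) =
        ((N : ℂ) ^ k) • complexBetti.map (fiberι f t) k w) →
      (∀ (k k₁ k₂ : ℕ), k₁ + 1 = k → k₂ + 1 = k₁ → ∀ w : complexBetti 𝒳 k, ∃ w₀ w₁ w₂ : complexBetti 𝒳 k,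
        w = w₀ + w₁ + w₂ ∧ complexBetti.map ν k w₀ = ((N : ℂ) ^ k) • w₀ ∧ complexBetti.map ν k w₁ = ((N : ℂ) ^ k₁) • w₁ ∧
        complexBetti.map ν k w₂ = ((N : ℂ) ^ k₂) • w₂) →
      (∀ (k : ℕ) (G : complexBetti 𝒳 k), complexBetti.map ν k G = ((N : ℂ) ^ k) • G →
        complexBetti.map (fiberι f t) k G = 0 → G = 0) →
      ∀ (p : ℕ) (y₀ : complexBetti 𝒳 (2 * (p + 1))),
        complexBetti.map ν (2 * (p + 1)) y₀ = ((N : ℂ) ^ (2 * (p + 1))) • y₀ → IsRationalClass y₀ →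
        IsOfHodgeType (d + 1) 𝒳 (2 * (p + 1)) (p + 1) (p + 1) y₀ → y₀ ∈ algebraicClasses 𝒳 (p + 1)

/-- DISPLAY-ONLY bracket (no `def`; REFEREE-AB F-ab-103): `CMTopWeightLifts[]` of part XXIV-c, restated verbatim. OPEN; a HYPOTHESIS. -/
local notation3 (prettyPrint := false) "CMTopWeightLifts[]" =>
  ∀ ⦃d : ℕ⦄ ⦃𝒳 S : SchemeOver ℂ⦄ (f : 𝒳 ⟶ S), IsCompactAbelianPencil f d → ∀ t ∈ cmLocus f d,
    ∀ (ν : 𝒳 ⟶ 𝒳) (_ : LocallyQuasiFinite ν.left) (N : ℕ), 2 ≤ N →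
      (∀ (k : ℕ) (w : complexBetti 𝒳 k), complexBetti.map (fiberι f t) k (complexBetti.map ν k w) =
        ((N : ℂ) ^ k) • complexBetti.map (fiberι f t) k w) →
      (∀ (k k₁ k₂ : ℕ), k₁ + 1 = k → k₂ + 1 = k₁ → ∀ w : complexBetti 𝒳 k, ∃ w₀ w₁ w₂ : complexBetti 𝒳 k,
        w = w₀ + w₁ + w₂ ∧ complexBetti.map ν k w₀ = ((N : ℂ) ^ k) • w₀ ∧ complexBetti.map ν k w₁ = ((N : ℂ) ^ k₁) • w₁ ∧
        complexBetti.map ν k w₂ = ((N : ℂ) ^ k₂) • w₂) →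
      (∀ (k : ℕ) (G : complexBetti 𝒳 k), complexBetti.map ν k G = ((N : ℂ) ^ k) • G →
        complexBetti.map (fiberι f t) k G = 0 → G = 0) →
      ∀ (p : ℕ) (y₀ : complexBetti 𝒳 (2 * (p + 1))),
        complexBetti.map ν (2 * (p + 1)) y₀ = ((N : ℂ) ^ (2 * (p + 1))) • y₀ →
        complexBetti.map (fiberι f t) (2 * (p + 1)) y₀ ∈ algebraicClasses (fiberOver f t) (p + 1) →
        y₀ ∈ algebraicClasses 𝒳 (p + 1)

/-- DISPLAY-ONLY bracket (no `def`, not a census node — REFEREE-AB F-ab-103): **`CMThetaRoots[]`** — at every CM point `t` of every compact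
pencil of abelian varieties there are a locally quasi-finite `ν : 𝒳 ⟶ 𝒳` and `N ≥ 2` such that (θ) `ν` restricts along `j_t` to an
endomorphism `ν_t` of `X_t` identified with `N · 𝟙_A` by a chart `e : A.X ≅ X_t` (GEOMETRIC: the multiplication `θ_N` of the abelian scheme —
a compact pencil is an abelian scheme, Mumford GIT Thm. 6.14; `θ_N` is finite and restricts to `[N]` on each fibre), and (roots) in every
degree `k`, on `ker j_t^* ⊂ Hᵏ(𝒳)`: `ν^*ν^* - (N^{k-1} + N^{k-2}) ν^* + N^{k-1}N^{k-2} = 0` (SPECTRAL: `ker j_t^* = H¹(S, R^{k-1}) ⊕ H²(S, R^{k-2})`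
with `θ_N^*`-weights `N^{k-1}, N^{k-2}` — the Leray spectral sequence of the abelian scheme; Deninger–Murre Thm. 3.1). A PRINT THEOREM that the
tree does not yet prove; displayed as a hypothesis; strictly fewer spectral clauses than `CMWeights[]` (one instead of three). -/
local notation3 (prettyPrint := false) "CMThetaRoots[]" =>
  ∀ ⦃d : ℕ⦄ ⦃𝒳 S : SchemeOver ℂ⦄ (f : 𝒳 ⟶ S), IsCompactAbelianPencil f d → ∀ t ∈ cmLocus f d,
    ∃ (ν : 𝒳 ⟶ 𝒳) (_ : LocallyQuasiFinite ν.left) (N : ℕ), 2 ≤ N ∧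
      (∃ (νt : fiberOver f t ⟶ fiberOver f t) (A : AbelianVariety ℂ) (e : A.X ≅ fiberOver f t),
        νt ≫ fiberι f t = fiberι f t ≫ ν ∧ e.hom ≫ νt = (N • 𝟙 A).hom.hom.hom ≫ e.hom) ∧
      (∀ (k : ℕ) (w : complexBetti 𝒳 k), complexBetti.map (fiberι f t) k w = 0 →
        complexBetti.map ν k (complexBetti.map ν k w) - ((N : ℂ) ^ (k - 1) + (N : ℂ) ^ (k - 2)) • complexBetti.map ν k w +
          ((N : ℂ) ^ (k - 1) * (N : ℂ) ^ (k - 2)) • w = 0)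

/-- **`CMThetaRoots[] ⟹ CMWeights[]`**: the Leray weight package of part XXIV at a CM point follows from a fibrewise multiplication charted by
`[N]` (§3, giving (wt)) and the single spectral clause (roots) on `ker j_t^*` (§2, giving (wt₃) and (top); degree `0` by connectedness).
[cite: Milne2020HodgeClassesAV, proof of Prop. 1 (p. 7)] [cite: Kleiman1968AlgebraicCycles, p. 374] [cite: DeningerMurre1991, Thm. 3.1]
[cite: MumfordGIT, Thm. 6.14] -/
theorem cmWeights_of_cmThetaRoots (hΘ : CMThetaRoots[]) : CMWeights[] := by
  intro d 𝒳 S f hf t ht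
  obtain ⟨ν, hν, N, hN, ⟨νt, A, e, hνt, he⟩, hroots⟩ := hΘ f hf t ht
  have hwt : ∀ (k : ℕ) (w : complexBetti 𝒳 k), complexBetti.map (fiberι f t) k (complexBetti.map ν k w) =
      ((N : ℂ) ^ k) • complexBetti.map (fiberι f t) k w :=
    fun k w ↦ fibreWeight_of_chart t ν νt hνt A e N he k w
  refine ⟨ν, hν, N, hN, hwt, fun k k₁ k₂ hk₁ hk₂ w ↦ weights₃_of_roots t ν hN hk₁ hk₂ (hwt k) (hroots k) w, fun k G hG hjG ↦ ?_⟩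
  rcases Nat.eq_zero_or_pos k with rfl | hk
  · exact top_zero hf t hjG
  · exact top_of_roots t ν hN hk (hroots k) hG hjG

/-- **`HC_CM ∧ [CM top-weight Hodge classes algebraic] ⟹ HC_AV`, granted [h₂₁] and `CMThetaRoots[]`** (binders in this order; `HC_CM` =
`RankFourFaces.CMAbelianHodge` a HYPOTHESIS, load-bearing): part XXIV-d's deliverable row with its weight bracket replaced by the smaller one.
research route, not a corollary; conditional on HC_CM plus one named minimal statement. [cite: Andre1996Motifs, Lemme 6.3.1 (p. 31) and Remarque 2 (p. 33)]
[cite: Milne2020HodgeClassesAV, proof of Prop. 1 (pp. 7–8)] -/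
theorem HC_AV_of_HC_CM_of_cmTopWeightHodge_of_thetaRoots (h₂₁ : andre1996_cmAnchoredPencil) (hΘ : CMThetaRoots[])
    (hCM : RankFourFaces.CMAbelianHodge) (h : CMTopWeightHodge[]) : PadicSemiregularLift.HodgeAbelianVarieties :=
  HC_AV_of_HC_CM_of_cmTopWeightHodge h₂₁ (cmWeights_of_cmThetaRoots hΘ) hCM h

/-- **EXACTNESS: `HC_AV ⟺ HC_CM ∧ [CM top-weight Hodge classes algebraic]`, granted [h₂₁], Verdier and `CMThetaRoots[]`.**
[cite: Andre1996Motifs, Lemme 6.3.1 (p. 31) and Remarque 2 (p. 33)] [cite: Verdier1976, Cor. 5.1] [cite: Milne2020HodgeClassesAV, proof of Prop. 1 (pp. 7–8)] -/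
theorem HC_AV_iff_HC_CM_and_cmTopWeightHodge_of_verdier_of_thetaRoots (h₂₁ : andre1996_cmAnchoredPencil)
    (hGT : Verdier1976_genericLocalTriviality) (hΘ : CMThetaRoots[]) :
    PadicSemiregularLift.HodgeAbelianVarieties ↔ (RankFourFaces.CMAbelianHodge ∧ CMTopWeightHodge[]) :=
  HC_AV_iff_HC_CM_and_cmTopWeightHodge_of_verdier h₂₁ hGT (cmWeights_of_cmThetaRoots hΘ)

/-- **`HC_CM ∧ [CM top-weight lifts] ⟹ HC_AV`, granted [h₂₁] and `CMThetaRoots[]`** (part XXIV-c's row with the smaller weight bracket).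
[cite: Andre1996Motifs, Lemme 6.3.1 (p. 31) and Remarque 2 (p. 33)] [cite: Milne2020HodgeClassesAV, proof of Prop. 1 (pp. 7–8)] -/
theorem HC_AV_of_HC_CM_of_cmTopWeightLifts_of_thetaRoots (h₂₁ : andre1996_cmAnchoredPencil) (hΘ : CMThetaRoots[])
    (hCM : RankFourFaces.CMAbelianHodge) (h : CMTopWeightLifts[]) : PadicSemiregularLift.HodgeAbelianVarieties :=
  HC_AV_of_HC_CM_of_cmTopWeightLifts h₂₁ (cmWeights_of_cmThetaRoots hΘ) hCM h

/-- **(L) ⟺ [CM top-weight lifts], granted `CMThetaRoots[]`.** [cite: Milne2020HodgeClassesAV, proof of Prop. 1 (pp. 7–8)] [cite: Andre1996Motifs, §5.1 (p. 25)] -/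
theorem cmFibreAlgebraicLift_iff_cmTopWeightLifts_of_thetaRoots (hΘ : CMThetaRoots[]) : CMFibreAlgebraicLift ↔ CMTopWeightLifts[] :=
  cmFibreAlgebraicLift_iff_cmTopWeightLifts (cmWeights_of_cmThetaRoots hΘ)

/-- **EXACTNESS: `HC_AV ⟺ HC_CM ∧ [CM top-weight lifts]`, granted [h₂₁], Verdier and `CMThetaRoots[]`.**
[cite: Andre1996Motifs, Lemme 6.3.1 (p. 31) and Remarque 2 (p. 33)] [cite: Verdier1976, Cor. 5.1] -/
theorem HC_AV_iff_HC_CM_and_cmTopWeightLifts_of_verdier_of_thetaRoots (h₂₁ : andre1996_cmAnchoredPencil)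
    (hGT : Verdier1976_genericLocalTriviality) (hΘ : CMThetaRoots[]) :
    PadicSemiregularLift.HodgeAbelianVarieties ↔ (RankFourFaces.CMAbelianHodge ∧ CMTopWeightLifts[]) :=
  HC_AV_iff_HC_CM_and_cmTopWeightLifts_of_verdier h₂₁ hGT (cmWeights_of_cmThetaRoots hΘ)

end Nodes

end Summit.HodgeConjecture.HodgeConjecture.Ring2.AbelianAll

end
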